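import Mathlib

/-!
# PneNP / OverlapGapAlgebra — `SearchHardWindow`, strong Lipschitz rung (1/3): clause-degree tails

Support for crux `stmt-PneNP-2460` (`Summit.PneNP.PneNP.Theses.OverlapGapAlgebra.SearchHardWindow`).
Pure counting facts about the with-replacement literal model `Φ : Fin m → Fin k → Fin n × Bool`
(`m` clauses, `k` literal slots, literal = (variable, sign)), needed for the variance step of the
strong Lipschitz rung (`OverlapGapAlgebraSearchHardWindowLipschitzRungVariance.lean`):
the clause-degree `cdeg Φ v = #{i : ∃ j, (Φ i j).1 = v}` of a variable and the maximum clause-degree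
`D Φ = sup_v cdeg Φ v` (written inline; no definitions).
* `shwL_card_slotHit` — exactly a `1/n` fraction of clauses carry `v` in a given slot;
* `shwL_card_multiHit_le` — `n^{#T} · #{Φ : every clause in T contains v} ≤ k^{#T} · #instances`;
* `shwL_card_cdeg_gt_le`, `shwL_card_maxdeg_gt_le` — union bounds:
  `n^{L+1} · #{Φ : L < D Φ} ≤ n · C(m, L+1) · k^{L+1} · #instances`;
* `shwL_sum_maxdeg_sq_le` — at linear density `m ≤ α n`, eventually in `n`,
  `∑_Φ D(Φ)² ≤ 10 (log n)² · #instances` (take `L = ⌈2 log n⌉`, `x^j/j! ≤ e^x`).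
[folklore: balls-in-bins maximum load] No new definitions; Mathlib only.
-/

set_option linter.dupNamespace false -- `Summit.PneNP.PneNP.…`: summit = sub-problem (D-0017)

namespace Summit.PneNP.PneNP.Theorems

open Finset Filter
open scoped Classical

section Count

variable {m k n : ℕ}

/-- Literals on a fixed variable: `#{ℓ : Fin n × Bool | ℓ.1 = v} = 2`. -/
theorem shwL_card_litsOn (v : Fin n) :
    ((univ : Finset (Fin n × Bool)).filter fun ℓ => ℓ.1 = v).card = 2 := by
  have : ((univ : Finset (Fin n × Bool)).filter fun ℓ => ℓ.1 = v) = {(v, true), (v, false)} := by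
    ext ⟨w, b⟩
    cases b <;> simp
  rw [this]
  exact Finset.card_pair (by simp)

/-- Clauses carrying variable `v` in slot `j`: `n · #{cl | (cl j).1 = v} = #clauses`. -/
theorem shwL_card_slotHit (j : Fin k) (v : Fin n) :
    n * ((univ : Finset (Fin k → Fin n × Bool)).filter fun cl => (cl j).1 = v).card
      = Fintype.card (Fin k → Fin n × Bool) := by
  set t : Fin k → Finset (Fin n × Bool) :=
    Function.update (fun _ => (univ : Finset (Fin n × Bool))) j
      ((univ : Finset (Fin n × Bool)).filter fun ℓ => ℓ.1 = v) with ht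
  have hset : ((univ : Finset (Fin k → Fin n × Bool)).filter fun cl => (cl j).1 = v)
      = Fintype.piFinset t := by
    ext cl
    simp only [mem_filter, mem_univ, true_and, Fintype.mem_piFinset, ht]
    constructor
    · intro h a
      by_cases ha : a = j
      · subst ha; simp [h]
      · simp [Function.update_of_ne ha]
    · intro h
      have := h j
      simpa using this
  rw [hset, Fintype.card_piFinset]
  have hti : ∀ i, (t i).card = if i = j then 2 else Fintype.card (Fin n × Bool) := by
    intro i
    by_cases hi : i = j
    · subst hi
      simp only [ht, Function.update_self, if_true]
      exact shwL_card_litsOn v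
    · simp only [ht, Function.update_of_ne hi, hi, if_false, Finset.card_univ]
  simp_rw [hti]
  rw [Finset.prod_ite, Finset.prod_const, Finset.prod_const, Finset.filter_eq', if_pos (mem_univ j),
    Finset.card_singleton, Finset.filter_ne', Finset.card_erase_of_mem (mem_univ j), Finset.card_univ,
    Fintype.card_fin, Fintype.card_fun, Fintype.card_prod, Fintype.card_fin, Fintype.card_bool,
    Fintype.card_fin]
  obtain ⟨k', rfl⟩ : ∃ k', k = k' + 1 := ⟨k - 1, (Nat.succ_pred_eq_of_pos j.pos).symm⟩
  rw [Nat.add_sub_cancel]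
  ring

/-- Clauses containing variable `v` somewhere: `n · #{cl | ∃ j, (cl j).1 = v} ≤ k · #clauses`. -/
theorem shwL_card_hit_le (v : Fin n) :
    n * ((univ : Finset (Fin k → Fin n × Bool)).filter fun cl => ∃ j, (cl j).1 = v).card
      ≤ k * Fintype.card (Fin k → Fin n × Bool) := by
  have hsub : ((univ : Finset (Fin k → Fin n × Bool)).filter fun cl => ∃ j, (cl j).1 = v)
      ⊆ (univ : Finset (Fin k)).biUnion fun j =>
          (univ : Finset (Fin k → Fin n × Bool)).filter fun cl => (cl j).1 = v := by
    intro cl hcl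
    simp only [mem_filter, mem_univ, true_and] at hcl
    obtain ⟨j, hj⟩ := hcl
    exact Finset.mem_biUnion.2 ⟨j, mem_univ j, by simp [hj]⟩
  calc n * ((univ : Finset (Fin k → Fin n × Bool)).filter fun cl => ∃ j, (cl j).1 = v).card
      ≤ n * ∑ j : Fin k, ((univ : Finset (Fin k → Fin n × Bool)).filter fun cl => (cl j).1 = v).card :=
        Nat.mul_le_mul_left _ ((Finset.card_le_card hsub).trans Finset.card_biUnion_le)
    _ = ∑ j : Fin k, Fintype.card (Fin k → Fin n × Bool) := by
        rw [Finset.mul_sum]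
        exact Finset.sum_congr rfl fun j _ => shwL_card_slotHit j v
    _ = k * Fintype.card (Fin k → Fin n × Bool) := by
        rw [Finset.sum_const, Finset.card_univ, Fintype.card_fin, smul_eq_mul]

/-- Instances all of whose clauses in `T` contain `v`: `n^{#T} · #{Φ | ∀ i ∈ T, ∃ j, (Φ i j).1 = v}
≤ k^{#T} · #instances` (product structure of the literal model). -/
theorem shwL_card_multiHit_le (T : Finset (Fin m)) (v : Fin n) :
    n ^ T.card * ((univ : Finset (Fin m → Fin k → Fin n × Bool)).filter
        fun Φ => ∀ i ∈ T, ∃ j, (Φ i j).1 = v).card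
      ≤ k ^ T.card * Fintype.card (Fin m → Fin k → Fin n × Bool) := by
  set H : Finset (Fin k → Fin n × Bool) :=
    (univ : Finset (Fin k → Fin n × Bool)).filter fun cl => ∃ j, (cl j).1 = v with hH
  set t : Fin m → Finset (Fin k → Fin n × Bool) := fun i => if i ∈ T then H else univ with ht
  have hset : ((univ : Finset (Fin m → Fin k → Fin n × Bool)).filter fun Φ => ∀ i ∈ T, ∃ j, (Φ i j).1 = v)
      = Fintype.piFinset t := by
    ext Φ
    simp only [mem_filter, mem_univ, true_and, Fintype.mem_piFinset, ht]
    constructor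
    · intro h i
      by_cases hi : i ∈ T
      · simp only [hi, if_true, hH, mem_filter, mem_univ, true_and]; exact h i hi
      · simp [hi]
    · intro h i hi
      have := h i
      simp only [hi, if_true, hH, mem_filter, mem_univ, true_and] at this
      exact this
  have hcard : (Fintype.piFinset t).card = H.card ^ T.card *
      (Fintype.card (Fin k → Fin n × Bool)) ^ (m - T.card) := by
    rw [Fintype.card_piFinset]
    have hti : ∀ i, (t i).card = if i ∈ T then H.card else Fintype.card (Fin k → Fin n × Bool) := by
      intro i
      by_cases hi : i ∈ T
      · simp only [ht, hi, if_true]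
      · simp only [ht, hi, if_false, Finset.card_univ]
    simp_rw [hti]
    rw [Finset.prod_ite, Finset.prod_const, Finset.prod_const, Finset.filter_mem_eq_inter,
      Finset.univ_inter]
    congr 2
    have : ((univ : Finset (Fin m)).filter fun i => ¬ i ∈ T) = univ \ T := by
      ext i; simp
    rw [this, Finset.card_univ_sdiff, Fintype.card_fin]
  rw [hset, hcard]
  have hHle : n * H.card ≤ k * Fintype.card (Fin k → Fin n × Bool) := shwL_card_hit_le v
  have hTm : T.card ≤ m := by simpa using Finset.card_le_univ T
  calc n ^ T.card * (H.card ^ T.card * Fintype.card (Fin k → Fin n × Bool) ^ (m - T.card))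
      = (n * H.card) ^ T.card * Fintype.card (Fin k → Fin n × Bool) ^ (m - T.card) := by
        rw [mul_pow]; ring
    _ ≤ (k * Fintype.card (Fin k → Fin n × Bool)) ^ T.card *
          Fintype.card (Fin k → Fin n × Bool) ^ (m - T.card) :=
        Nat.mul_le_mul_right _ (Nat.pow_le_pow_left hHle _)
    _ = k ^ T.card * Fintype.card (Fin m → Fin k → Fin n × Bool) := by
        rw [mul_pow, mul_assoc, ← pow_add, Nat.add_sub_cancel' hTm]
        conv_rhs => rw [Fintype.card_fun, Fintype.card_fin]

/-- Clause-degree tail for one variable: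
`n^{L+1} · #{Φ | L < #{i : ∃ j, (Φ i j).1 = v}} ≤ C(m, L+1) · k^{L+1} · #instances`. -/
theorem shwL_card_cdeg_gt_le (L : ℕ) (v : Fin n) :
    n ^ (L + 1) * ((univ : Finset (Fin m → Fin k → Fin n × Bool)).filter fun Φ =>
        L < ((univ : Finset (Fin m)).filter fun i => ∃ j, (Φ i j).1 = v).card).card
      ≤ m.choose (L + 1) * k ^ (L + 1) * Fintype.card (Fin m → Fin k → Fin n × Bool) := by
  have hsub : ((univ : Finset (Fin m → Fin k → Fin n × Bool)).filter fun Φ =>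
        L < ((univ : Finset (Fin m)).filter fun i => ∃ j, (Φ i j).1 = v).card)
      ⊆ (Finset.powersetCard (L + 1) (univ : Finset (Fin m))).biUnion fun T =>
          (univ : Finset (Fin m → Fin k → Fin n × Bool)).filter fun Φ => ∀ i ∈ T, ∃ j, (Φ i j).1 = v := by
    intro Φ hΦ
    simp only [mem_filter, mem_univ, true_and] at hΦ
    obtain ⟨T, hT, hTcard⟩ := Finset.exists_subset_card_eq (Nat.succ_le_of_lt hΦ)
    refine Finset.mem_biUnion.2 ⟨T, ?_, ?_⟩
    · exact Finset.mem_powersetCard.2 ⟨Finset.subset_univ _, hTcard⟩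
    · simp only [mem_filter, mem_univ, true_and]
      intro i hi
      have := hT hi
      simpa using this
  calc n ^ (L + 1) * ((univ : Finset (Fin m → Fin k → Fin n × Bool)).filter fun Φ =>
          L < ((univ : Finset (Fin m)).filter fun i => ∃ j, (Φ i j).1 = v).card).card
      ≤ n ^ (L + 1) * ∑ T ∈ Finset.powersetCard (L + 1) (univ : Finset (Fin m)),
          ((univ : Finset (Fin m → Fin k → Fin n × Bool)).filter
            fun Φ => ∀ i ∈ T, ∃ j, (Φ i j).1 = v).card :=
        Nat.mul_le_mul_left _ ((Finset.card_le_card hsub).trans Finset.card_biUnion_le)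
    _ = ∑ T ∈ Finset.powersetCard (L + 1) (univ : Finset (Fin m)),
          n ^ T.card * ((univ : Finset (Fin m → Fin k → Fin n × Bool)).filter
            fun Φ => ∀ i ∈ T, ∃ j, (Φ i j).1 = v).card := by
        rw [Finset.mul_sum]
        refine Finset.sum_congr rfl fun T hT => ?_
        rw [(Finset.mem_powersetCard.1 hT).2]
    _ ≤ ∑ T ∈ Finset.powersetCard (L + 1) (univ : Finset (Fin m)),
          k ^ (L + 1) * Fintype.card (Fin m → Fin k → Fin n × Bool) := by
        refine Finset.sum_le_sum fun T hT => ?_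
        have := shwL_card_multiHit_le (k := k) (n := n) T v
        rw [(Finset.mem_powersetCard.1 hT).2] at this ⊢
        exact this
    _ = m.choose (L + 1) * k ^ (L + 1) * Fintype.card (Fin m → Fin k → Fin n × Bool) := by
        rw [Finset.sum_const, Finset.card_powersetCard, Finset.card_univ, Fintype.card_fin,
          smul_eq_mul, mul_assoc]

/-- Maximum clause-degree tail (union over the `n` variables):
`n^{L+1} · #{Φ | L < D Φ} ≤ n · C(m, L+1) · k^{L+1} · #instances`,
`D Φ = sup_v #{i : ∃ j, (Φ i j).1 = v}`. [folklore: balls-in-bins maximum load] -/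
theorem shwL_card_maxdeg_gt_le (L : ℕ) :
    n ^ (L + 1) * ((univ : Finset (Fin m → Fin k → Fin n × Bool)).filter fun Φ =>
        L < (univ : Finset (Fin n)).sup fun v =>
          ((univ : Finset (Fin m)).filter fun i => ∃ j, (Φ i j).1 = v).card).card
      ≤ n * (m.choose (L + 1) * k ^ (L + 1) * Fintype.card (Fin m → Fin k → Fin n × Bool)) := by
  have hsub : ((univ : Finset (Fin m → Fin k → Fin n × Bool)).filter fun Φ =>
        L < (univ : Finset (Fin n)).sup fun v =>
          ((univ : Finset (Fin m)).filter fun i => ∃ j, (Φ i j).1 = v).card)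
      ⊆ (univ : Finset (Fin n)).biUnion fun v =>
          (univ : Finset (Fin m → Fin k → Fin n × Bool)).filter fun Φ =>
            L < ((univ : Finset (Fin m)).filter fun i => ∃ j, (Φ i j).1 = v).card := by
    intro Φ hΦ
    simp only [mem_filter, mem_univ, true_and] at hΦ
    obtain ⟨v, -, hv⟩ := Finset.lt_sup_iff.1 hΦ
    exact Finset.mem_biUnion.2 ⟨v, mem_univ v, by simpa using hv⟩
  calc n ^ (L + 1) * ((univ : Finset (Fin m → Fin k → Fin n × Bool)).filter fun Φ =>
          L < (univ : Finset (Fin n)).sup fun v =>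
            ((univ : Finset (Fin m)).filter fun i => ∃ j, (Φ i j).1 = v).card).card
      ≤ n ^ (L + 1) * ∑ v : Fin n, ((univ : Finset (Fin m → Fin k → Fin n × Bool)).filter fun Φ =>
          L < ((univ : Finset (Fin m)).filter fun i => ∃ j, (Φ i j).1 = v).card).card :=
        Nat.mul_le_mul_left _ ((Finset.card_le_card hsub).trans Finset.card_biUnion_le)
    _ ≤ ∑ v : Fin n, m.choose (L + 1) * k ^ (L + 1) * Fintype.card (Fin m → Fin k → Fin n × Bool) := by
        rw [Finset.mul_sum]
        exact Finset.sum_le_sum fun v _ => shwL_card_cdeg_gt_le L v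
    _ = n * (m.choose (L + 1) * k ^ (L + 1) * Fintype.card (Fin m → Fin k → Fin n × Bool)) := by
        rw [Finset.sum_const, Finset.card_univ, Fintype.card_fin, smul_eq_mul]

/-- The maximum clause-degree is at most `m`. -/
theorem shwL_maxdeg_le (Φ : Fin m → Fin k → Fin n × Bool) :
    ((univ : Finset (Fin n)).sup fun v =>
        ((univ : Finset (Fin m)).filter fun i => ∃ j, (Φ i j).1 = v).card) ≤ m := by
  refine Finset.sup_le fun v _ => ?_
  exact (Finset.card_filter_le _ _).trans (by rw [Finset.card_univ, Fintype.card_fin])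

end Count

section Real

variable {m k n : ℕ}

/-- Real form of the maximum clause-degree tail at linear density: if `1 ≤ n` and `m ≤ α n` then
`#{Φ | L < D Φ} ≤ n · e^{α k e²} · e^{-2(L+1)} · #instances`
(`C(m,L+1)(k/n)^{L+1} ≤ (αk)^{L+1}/(L+1)! ≤ e^{αke²} e^{-2(L+1)}` by `x^j/j! ≤ e^x`). -/
theorem shwL_card_maxdeg_gt_le_real (L : ℕ) {α : ℝ} (hα : 0 ≤ α) (hn : 1 ≤ n) (hm : (m : ℝ) ≤ α * n) :
    (((univ : Finset (Fin m → Fin k → Fin n × Bool)).filter fun Φ =>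
        L < (univ : Finset (Fin n)).sup fun v =>
          ((univ : Finset (Fin m)).filter fun i => ∃ j, (Φ i j).1 = v).card).card : ℝ)
      ≤ n * (Real.exp (α * k * Real.exp 2) * Real.exp (-(2 * (L + 1)))) *
          Fintype.card (Fin m → Fin k → Fin n × Bool) := by
  set N : ℝ := (Fintype.card (Fin m → Fin k → Fin n × Bool) : ℝ) with hN
  set X : ℝ := (((univ : Finset (Fin m → Fin k → Fin n × Bool)).filter fun Φ =>
        L < (univ : Finset (Fin n)).sup fun v =>
          ((univ : Finset (Fin m)).filter fun i => ∃ j, (Φ i j).1 = v).card).card : ℝ) with hX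
  have hnR : (0 : ℝ) < n := by exact_mod_cast hn
  have hnat := shwL_card_maxdeg_gt_le (m := m) (k := k) (n := n) L
  have hreal : (n : ℝ) ^ (L + 1) * X ≤ n * ((m.choose (L + 1) : ℝ) * (k : ℝ) ^ (L + 1) * N) := by
    rw [hX, hN]; exact_mod_cast hnat
  -- `C(m, L+1) k^{L+1} ≤ (α k n)^{L+1}/(L+1)!`
  have hchoose : (m.choose (L + 1) : ℝ) ≤ (m : ℝ) ^ (L + 1) / (L + 1).factorial :=
    Nat.choose_le_pow_div (L + 1) m
  have hfpos : (0 : ℝ) < (L + 1).factorial := by exact_mod_cast Nat.factorial_pos _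
  have hmk : (m.choose (L + 1) : ℝ) * (k : ℝ) ^ (L + 1)
      ≤ (α * k) ^ (L + 1) / (L + 1).factorial * (n : ℝ) ^ (L + 1) := by
    have h1 : (m : ℝ) ^ (L + 1) ≤ (α * n) ^ (L + 1) :=
      pow_le_pow_left₀ (Nat.cast_nonneg _) hm _
    calc (m.choose (L + 1) : ℝ) * (k : ℝ) ^ (L + 1)
        ≤ (m : ℝ) ^ (L + 1) / (L + 1).factorial * (k : ℝ) ^ (L + 1) :=
          mul_le_mul_of_nonneg_right hchoose (by positivity)
      _ ≤ (α * n) ^ (L + 1) / (L + 1).factorial * (k : ℝ) ^ (L + 1) := by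
          gcongr
      _ = (α * k) ^ (L + 1) / (L + 1).factorial * (n : ℝ) ^ (L + 1) := by
          rw [mul_pow, mul_pow]; ring
  -- `(αk)^{L+1}/(L+1)! ≤ e^{αke²} e^{-2(L+1)}`
  have hexp : (α * k) ^ (L + 1) / (L + 1).factorial
      ≤ Real.exp (α * k * Real.exp 2) * Real.exp (-(2 * (L + 1))) := by
    have h0 : 0 ≤ α * k * Real.exp 2 := by positivity
    have key := Real.pow_div_factorial_le_exp _ h0 (L + 1)
    have hsplit : (α * k * Real.exp 2) ^ (L + 1) = (α * k) ^ (L + 1) * Real.exp (2 * (L + 1)) := by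
      rw [mul_pow, ← Real.exp_nat_mul]; push_cast; ring_nf
    rw [hsplit] at key
    have hE : 0 < Real.exp (2 * (L + 1)) := Real.exp_pos _
    rw [Real.exp_neg]
    rw [mul_div_assoc] at key
    rw [show (α * k) ^ (L + 1) / ((L + 1).factorial : ℝ)
        = (α * k) ^ (L + 1) * (Real.exp (2 * (L + 1)) / (L + 1).factorial) * (Real.exp (2 * (L + 1)))⁻¹ by
      field_simp]
    exact mul_le_mul_of_nonneg_right key (inv_nonneg.2 hE.le)
  have hNn : 0 ≤ N := by rw [hN]; exact Nat.cast_nonneg _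
  have step : (n : ℝ) ^ (L + 1) * X
      ≤ (n : ℝ) ^ (L + 1) * (n * (Real.exp (α * k * Real.exp 2) * Real.exp (-(2 * (L + 1)))) * N) := by
    calc (n : ℝ) ^ (L + 1) * X ≤ n * ((m.choose (L + 1) : ℝ) * (k : ℝ) ^ (L + 1) * N) := hreal
      _ ≤ n * ((α * k) ^ (L + 1) / (L + 1).factorial * (n : ℝ) ^ (L + 1) * N) := by
          gcongr
      _ ≤ n * (Real.exp (α * k * Real.exp 2) * Real.exp (-(2 * (L + 1))) * (n : ℝ) ^ (L + 1) * N) := by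
          gcongr
      _ = (n : ℝ) ^ (L + 1) * (n * (Real.exp (α * k * Real.exp 2) * Real.exp (-(2 * (L + 1)))) * N) := by
          ring
  exact le_of_mul_le_mul_left step (by positivity)

/-- Second moment of the maximum clause-degree, split at level `L`:
`∑_Φ D(Φ)² ≤ L² · #instances + m² · #{Φ | L < D Φ}`. -/
theorem shwL_sum_maxdeg_sq_le_split (L : ℕ) :
    ∑ Φ : Fin m → Fin k → Fin n × Bool,
        (((univ : Finset (Fin n)).sup fun v =>
          ((univ : Finset (Fin m)).filter fun i => ∃ j, (Φ i j).1 = v).card : ℕ) : ℝ) ^ 2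
      ≤ (L : ℝ) ^ 2 * Fintype.card (Fin m → Fin k → Fin n × Bool) +
        (m : ℝ) ^ 2 * (((univ : Finset (Fin m → Fin k → Fin n × Bool)).filter fun Φ =>
          L < (univ : Finset (Fin n)).sup fun v =>
            ((univ : Finset (Fin m)).filter fun i => ∃ j, (Φ i j).1 = v).card).card : ℝ) := by
  set D : (Fin m → Fin k → Fin n × Bool) → ℕ := fun Φ => (univ : Finset (Fin n)).sup fun v =>
      ((univ : Finset (Fin m)).filter fun i => ∃ j, (Φ i j).1 = v).card with hD
  have hpt : ∀ Φ : Fin m → Fin k → Fin n × Bool,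
      ((D Φ : ℕ) : ℝ) ^ 2 ≤ (L : ℝ) ^ 2 + (m : ℝ) ^ 2 * (if L < D Φ then 1 else 0) := by
    intro Φ
    by_cases h : L < D Φ
    · rw [if_pos h, mul_one]
      have hDm : (D Φ : ℝ) ≤ m := by exact_mod_cast shwL_maxdeg_le Φ
      nlinarith [sq_nonneg (L : ℝ), pow_le_pow_left₀ (Nat.cast_nonneg (D Φ)) hDm 2]
    · rw [if_neg h, mul_zero, add_zero]
      have hDL : (D Φ : ℝ) ≤ L := by exact_mod_cast not_lt.1 h
      exact pow_le_pow_left₀ (Nat.cast_nonneg _) hDL 2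
  calc ∑ Φ : Fin m → Fin k → Fin n × Bool, ((D Φ : ℕ) : ℝ) ^ 2
      ≤ ∑ Φ : Fin m → Fin k → Fin n × Bool, ((L : ℝ) ^ 2 + (m : ℝ) ^ 2 * (if L < D Φ then 1 else 0)) :=
        Finset.sum_le_sum fun Φ _ => hpt Φ
    _ = (L : ℝ) ^ 2 * Fintype.card (Fin m → Fin k → Fin n × Bool) +
        (m : ℝ) ^ 2 * (((univ : Finset (Fin m → Fin k → Fin n × Bool)).filter fun Φ => L < D Φ).card : ℝ) := by
        rw [Finset.sum_add_distrib, Finset.sum_const, Finset.card_univ, nsmul_eq_mul, ← Finset.mul_sum,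
          Finset.sum_boole]
        ring

/-- **Second moment of the maximum clause-degree at linear density.** For `0 ≤ α`, eventually in
`n`: for every `m ≤ α n`, `∑_Φ D(Φ)² ≤ 10 (log n)² · #instances`, where
`D Φ = max_v #{i : ∃ j, (Φ i j).1 = v}` is the maximum clause-degree of the random `k`-CNF `Φ`
with `m` clauses over `n` variables (with-replacement literal model, counting form).
[folklore: maximum load of `km` balls in `n` bins is `O(log n)` in mean square] -/
theorem shwL_sum_maxdeg_sq_le (k : ℕ) {α : ℝ} (hα : 0 ≤ α) :
    ∀ᶠ n : ℕ in atTop, ∀ m : ℕ, (m : ℝ) ≤ α * n →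
      ∑ Φ : Fin m → Fin k → Fin n × Bool,
          (((univ : Finset (Fin n)).sup fun v =>
            ((univ : Finset (Fin m)).filter fun i => ∃ j, (Φ i j).1 = v).card : ℕ) : ℝ) ^ 2
        ≤ 10 * Real.log n ^ 2 * Fintype.card (Fin m → Fin k → Fin n × Bool) := by
  have h3 : ∀ᶠ n : ℕ in atTop, 3 ≤ n := eventually_ge_atTop 3
  have hbig : ∀ᶠ n : ℕ in atTop, α ^ 2 * Real.exp (α * k * Real.exp 2) ≤ (n : ℝ) :=
    tendsto_natCast_atTop_atTop.eventually_ge_atTop _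
  filter_upwards [h3, hbig] with n hn3 hnbig m hm
  set N : ℝ := (Fintype.card (Fin m → Fin k → Fin n × Bool) : ℝ) with hN
  have hn1 : 1 ≤ n := le_trans (by norm_num) hn3
  have hnR : (0 : ℝ) < n := by exact_mod_cast hn1
  have hNn : 0 ≤ N := by rw [hN]; exact Nat.cast_nonneg _
  -- log n ≥ 1 for n ≥ 3
  have hlog1 : 1 ≤ Real.log n := by
    rw [← Real.log_exp 1]
    apply Real.log_le_log (Real.exp_pos 1)
    have : Real.exp 1 ≤ 3 := le_of_lt (lt_trans Real.exp_one_lt_d9 (by norm_num))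
    exact this.trans (by exact_mod_cast hn3)
  set L : ℕ := ⌈2 * Real.log n⌉₊ with hL
  have hLge : 2 * Real.log n ≤ L := Nat.le_ceil _
  have hLle : (L : ℝ) ≤ 2 * Real.log n + 1 := by
    have := Nat.ceil_lt_add_one (show 0 ≤ 2 * Real.log n by positivity)
    exact le_of_lt this
  have hsplit := shwL_sum_maxdeg_sq_le_split (m := m) (k := k) (n := n) L
  have htail := shwL_card_maxdeg_gt_le_real (m := m) (k := k) (n := n) L hα hn1 hm
  -- e^{-2(L+1)} ≤ n^{-4}
  have hexpL : Real.exp (-(2 * (L + 1))) ≤ ((n : ℝ) ^ 4)⁻¹ := by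
    have h4 : 4 * Real.log n ≤ 2 * (L + 1 : ℝ) := by linarith
    rw [Real.exp_neg]
    apply inv_anti₀ (by positivity)
    calc (n : ℝ) ^ 4 = Real.exp (4 * Real.log n) := by
          rw [show (4 : ℝ) * Real.log n = ((4 : ℕ) : ℝ) * Real.log n by norm_num, Real.exp_nat_mul,
            Real.exp_log hnR]
      _ ≤ Real.exp (2 * (L + 1)) := Real.exp_le_exp.2 (by exact_mod_cast h4)
  -- tail term ≤ N
  have hm2 : (m : ℝ) ^ 2 ≤ α ^ 2 * (n : ℝ) ^ 2 := by
    rw [← mul_pow]; exact pow_le_pow_left₀ (Nat.cast_nonneg _) hm 2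
  have htail' : (m : ℝ) ^ 2 * (((univ : Finset (Fin m → Fin k → Fin n × Bool)).filter fun Φ =>
        L < (univ : Finset (Fin n)).sup fun v =>
          ((univ : Finset (Fin m)).filter fun i => ∃ j, (Φ i j).1 = v).card).card : ℝ) ≤ N := by
    calc _ ≤ (α ^ 2 * (n : ℝ) ^ 2) * (n * (Real.exp (α * k * Real.exp 2) * ((n : ℝ) ^ 4)⁻¹) * N) := by
          apply mul_le_mul hm2 _ (Nat.cast_nonneg _) (by positivity)
          calc _ ≤ n * (Real.exp (α * k * Real.exp 2) * Real.exp (-(2 * (L + 1)))) * N := htail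
            _ ≤ n * (Real.exp (α * k * Real.exp 2) * ((n : ℝ) ^ 4)⁻¹) * N := by gcongr
      _ = (α ^ 2 * Real.exp (α * k * Real.exp 2)) / n * N := by
          field_simp
      _ ≤ 1 * N := by
          apply mul_le_mul_of_nonneg_right _ hNn
          rw [div_le_one hnR]; exact hnbig
      _ = N := one_mul N
  -- main term: L² ≤ 9 log² n
  have hL2 : (L : ℝ) ^ 2 ≤ 9 * Real.log n ^ 2 := by nlinarith
  have hNlog : N ≤ Real.log n ^ 2 * N := le_mul_of_one_le_left hNn (one_le_pow₀ hlog1)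
  calc _ ≤ (L : ℝ) ^ 2 * N + (m : ℝ) ^ 2 * _ := hsplit
    _ ≤ 9 * Real.log n ^ 2 * N + N := by gcongr
    _ ≤ 10 * Real.log n ^ 2 * N := by linarith

end Real

end Summit.PneNP.PneNP.Theorems
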